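import Literature.MathematicalPhysics.QuantumFieldTheory.Balaban1983to89.Node00.TorusCoverLocalGauge
import Literature.MathematicalPhysics.QuantumFieldTheory.Balaban1983to89.Node00.LargeFieldBackgroundCoPOfRecord

/-!
# NODE 00 — THE TORUS→`ℤᵈ` TWIN, FILE 5: the FLOOR-CARRYING TWINS `Gauge152OfClassTopStepR` ∕ `Gauge9RegSepTopStepR` of the K0 road's (9)-tokens (plan g73
# RULING (A), shape (ii)-additive: binder `0 < ν.M₁` followed by the displayed floor `c ≤ ν.M₁`, floor letter `c : ℕ` a PARAMETER; p532575's floor-free facts untouched),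
# their algebra (old ⇒ new, antitone in the ceilings, ★ `gauge9R_of_prop8TopStep_of_gauge152R`), and ★★★ `gauge152R_of_prop6`: [6] PROPOSITION 6 AT NODE 00's `ℤᵈ`
# MEMBER ⇒ `Gauge152OfClassTopStepR F N suppDomOfRecord M ((44 + 3L)·L) B₉ a₀` FOR EVERY CUBE LETTER `M` — the (9)-half of the K0 road is N05's node by name

Cell `pub-ymgap`, seat `pub-ymgap-dag-n07-e` generation 10 (R141 (C) s3 «torus-vs-box twin», DAG node N07 = [15]; INTENT-29, bus 2026-08-27; plan g73 RULINGS (A)∕(B)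
l.20923: the V14 re-cut of the K0⁷ skeleton keys its stub 2 on `Gauge152OfClassTopStepR … suppDomOfRecord M c B₉ a₀''`).  NEW leaf; CONSUMED BY NAME, nothing modified:
this seat's p532575 (`Gauge152OfClassTopStep`, `Gauge9RegSepTopStep`, `Prop8RegSepTopStep` via `CriticalOnFibreTop`), FILES 1–4b of the twin (`exists_localGauge_cube_of_prop6`,
`cover_image_Ω_cubeIdx'_subset`, `exists_mem_box_within_of_mem_tcube`, `cubeExt_side_eq_box`, …), def-R's `suppDomOfRecord = hullD M₁ 1 (Ω 1)` ([III] p. 255), n02-b's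
`hullD`, r15's cover and `B15Claim189CubePin.(cubeOfSite, cubeOfSite_mem_cubeIndices, mem_cubeExt_cubeIdx_of_near)`.  `--kind definition --supports stmt-QuantumFields-20541` (K0⁷).
[15] = [Balaban1985Variational]; [6] = [Balaban1985RegularSpaces]; [I] = [Balaban1987RG1]; [III] = [Balaban1988Convergent].

WHY THE FLOOR (located, plan g72 COLLISION ∕ g73 RULING (A)).  [6] Prop. 6 ∕ [15] (144) work on the collared cube `□̃ ⊂ Ω_{k−1}` with collar `ρ = R₁M₁ ≥ L` and side
«11d < M′»; the only room the token's binder grants is print's separation layer (`Sect2.SeqSeparated ν.M₁ s`: one layer of `LⁿM₁`-cubes of `Ω_n` inside `Ω_{n−1}`,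
`n ≥ 2`) and, at `n = 1`, the support `suppDomOfRecord = Ω₁ +` one layer of scale-0 `M₁`-cubes ([III] p. 255).  The side-surplus recipe of FILE 2 (`M′ = M + 11d + L`,
`ρ = L`) fits iff `(11d + 3L)·Lⁿ ≤ M₁·Lⁿ` (n ≥ 2) and `(11d + 3L)·L ≤ M₁` (n = 1): ONE floor `c(d, L) = (11d + 3L)·L` serves every cube letter `M` (incl. the witness's
`M = 1`).  The floor-free p532575 tokens remain the located floor-free readings (not claimed false; not [6]'s theorem).

WHAT IS PROVED (kernel).  §1 `Gauge152OfClassTopStepR`, `Gauge9RegSepTopStepR` (2 named `Prop`s = p532575's texts with ONE more displayed hypothesis `c ≤ ν.M₁`) ·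
`Gauge152OfClassTopStep.toR` ∕ `Gauge9RegSepTopStep.toR` (old ⇒ new, any `c`) · `.of_le` (antitone in `a₀`) · `.mono_floor` (monotone in `c`) · ★ `gauge9R_of_prop8TopStep_of_gauge152R`
(p532575's reduction with the floor threaded).  §2 `cover_mem_hullD_one_of_within` (a cover point within `s` of a lift of `X` projects into `hullD s 1 X`) ·
`cover_image_Ω_cubeIdx'_one_subset_suppDom` (at `n = 1` the collar projects into the support, floor `(11d+3L)L ≤ M₁`).  §3 ★★★ `gauge152R_of_prop6` (d = 4).
HONEST FRAMING: two named facts (never asserted) + bookkeeping + ONE composition whose displayed input is [6] Prop. 6 at node00-def-cube's member over n05-a's index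
(N05's node — n05-e's `prop6Printed_zdCub_of_printed` ∕ `…_real₃` reduce it to [6] Thm 4 + Prop 3 ∕ [4]'s flat letters); nothing of Bałaban asserted or discharged here;
N07 ∕ N05 ∕ K0⁷ NOT discharged; counts unmoved (5∕27); one finite T⁴ programme at fixed ε — NOT continuum ∕ ℝ⁴ ∕ infinite volume ∕ OS ∕ mass gap ∕ Clay.
No `sorry`, no `instance`, no `notation`.
-/

noncomputable section

namespace Literature.MathematicalPhysics.QuantumFieldTheory.Balaban1983to89.Node00

open scoped Matrix.Norms.L2Operator
open T4Continuum (T4Family)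
open B15DeterminingSets B12RegularSpaces111
open B15Eq112TorusCover (cover per cover_add_pmul cover_eq_cover_iff cover_lift lift)
open B15LatticeCubeTorus (pmul)
open B14DomainGeom (Pt Within)
open B14.Eq213MaximalDomains (side cubeExt)
open B7Prop1Explicit (e)
open B8Eq131Cubes (box tcube bLo bHi)
open B8LeafModelZd (ZdIdx)
open B15Claim189CubePin (cubeOfSite cubeOfSite_mem_cubeIndices mem_cubeExt_cubeIdx_of_near)

/-! ## §1  The floor-carrying twins and their algebra -/

section Tokens

variable (F : T4Family) (N : ℕ) [NeZero N]

/-- ★★ **[15] (152) LINE 1 ∕ [6] THM 2 ON THE COLLARED CUBE FOR CLASS MEMBERS, WITH PRINT'S SEPARATION FLOOR DISPLAYED** — p532575's `Gauge152OfClassTopStep F N Sup M B₉ a₀`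
VERBATIM with ONE more hypothesis right after `0 < ν.M₁`: the floor `c ≤ ν.M₁` on the layer width of the (2.13) determining sets (the room [6] Prop. 6's collar `2R₁M₁Lʲη`
needs inside print's separation layer; `c` a PARAMETER like `M`).  A `Prop`, NEVER asserted. [cite: Balaban1985Variational, (144)–(152) pp.300–301, Thm 1 (9) p.279; Balaban1985RegularSpaces, Prop. 6 p.99, (1.3)–(1.6) p.77; Balaban1988Convergent, (2.13) p.256] -/
def Gauge152OfClassTopStepR (Sup : (ν : Stage7Numerics) → (K : ℕ) → (ℕ → Set (Site (F.P K) 0)) → Set (Site (F.P K) 0)) (M c : ℕ) (B₉ a₀ : ℝ) : Prop :=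
  ∀ (ν : Stage7Numerics) (g : ℕ → ℝ) (K k : ℕ) (s : SeqOfRecord F ν M g K k), Sect2.SeqSeparated ν.M₁ s → 0 < ν.M₁ → c ≤ ν.M₁ → 1 ≤ k →
    ∀ (ε : ℕ → ℝ),
    (∀ m, m ≤ k → 0 < ε m ∧ ε m ≤ a₀) → (∀ m, m < k → ε m ≤ 2 * ε (m + 1)) → (∀ m, m < k → ε (m + 1) ≤ 2 * ε m) →
      ∀ U : GaugeField (F.P K) 0 (SU N),
        (∀ m, m ≤ k → PlaqSmallOn (Sect2.omegaPlaqsTop s.Ω (Sup ν K s.Ω) m) (ε m * (F.P K).eta m ^ 2) U) →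
        (∀ m, m ≤ k → Sect2.CoDivSmallOn (Sect2.omegaBondsTop s.Ω (Sup ν K s.Ω) m) (ε m * (F.P K).eta m ^ 3) U) →
        ∀ n, 1 ≤ n → n ≤ k → ∀ S : ℕ,
          (S = B14.Eq213MaximalDomains.side (F.P K).L M n ∨ S = B14.Eq213MaximalDomains.side (F.P K).L M (n + 1)) → (S : ℤ) < (F.P K).sitesPerDir 0 →
          ∀ a ∈ cubeIndices (F.P K) S, cubeEnl (F.P K) S a 0 ⊆ s.Ω n →
            ∃ u : GaugeTransf (F.P K) 0 (SU N), ∃ A : PBond (F.P K) 0 → MatA N,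
              (∀ b ∈ (Sect2.regionOfSet (F.P K) (cubeEnl (F.P K) S a 0)).bonds,
                gaugeU (fun x => ιSU N (u x)) (fun b' => ιSU N (U b')) b = expI ((F.P K).eta n) (A b)) ∧
              (∀ b ∈ (Sect2.regionOfSet (F.P K) (cubeEnl (F.P K) S a 0)).bonds, ‖A b‖ < B₉ * ε n) ∧
              ∀ q ∈ (Sect2.regionOfSet (F.P K) (cubeEnl (F.P K) S a 0)).dpairs,
                ‖grad ((F.P K).eta n) q.2.1 (fun y => A ⟨y, q.2.2⟩) q.1‖ < B₉ * ε n

/-- ★★ **[15] THM 1 (9) LINE 1 FOR CRITICAL CONFIGURATIONS, WITH PRINT'S SEPARATION FLOOR DISPLAYED** — p532575's `Gauge9RegSepTopStep F N Sup M B₃ B₃' a₀ a₁` VERBATIM with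
the hypothesis `c ≤ ν.M₁` right after `0 < ν.M₁`.  A `Prop`, NEVER asserted. [cite: Balaban1985Variational, Thm 1 (9) p.279, Sect. F pp.300–305; Balaban1985RegularSpaces, (1.3)–(1.6) p.77; Balaban1988Convergent, (2.13) p.256] -/
def Gauge9RegSepTopStepR (Sup : (ν : Stage7Numerics) → (K : ℕ) → (ℕ → Set (Site (F.P K) 0)) → Set (Site (F.P K) 0)) (M c : ℕ) (B₃ B₃' a₀ a₁ : ℝ) : Prop :=
  ∀ (ν : Stage7Numerics) (g : ℕ → ℝ) (K k : ℕ) (s : SeqOfRecord F ν M g K k), Sect2.SeqSeparated ν.M₁ s → 0 < ν.M₁ → c ≤ ν.M₁ → 1 ≤ k →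
    ∀ (ε₀ : ℝ) (δ : ℕ → ℝ),
    (∀ n, n ≤ k → 0 < δ n ∧ δ n ≤ a₁ ∧ B₃ * δ n ≤ ε₀) → (∀ n, n < k → δ n ≤ 2 * δ (n + 1)) → (∀ n, n < k → δ (n + 1) ≤ 2 * δ n) → ε₀ ≤ a₀ →
    ∀ W : MSField (F.P K) (SU N), Sect2.DataSmall7PTop (avOfRecord F N K) s.Ω (Sup ν K s.Ω) k δ W →
      ∀ U : GaugeField (F.P K) 0 (SU N),
        (∀ n, n ≤ k → PlaqSmallOn (Sect2.omegaPlaqsTop s.Ω (Sup ν K s.Ω) n) (ε₀ * (F.P K).eta n ^ 2) U) →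
        Sect2.CoDivClassOnTop s.Ω (Sup ν K s.Ω) k ε₀ U → AgreeOn (genSet s.Ω k) (avgFamily (avOfRecord F N K) U) W →
        IsCritOnFibre F N K (genSet s.Ω k) W U →
        ∀ n, 1 ≤ n → n ≤ k → ∀ S : ℕ,
          (S = B14.Eq213MaximalDomains.side (F.P K).L M n ∨ S = B14.Eq213MaximalDomains.side (F.P K).L M (n + 1)) → (S : ℤ) < (F.P K).sitesPerDir 0 →
          ∀ a ∈ cubeIndices (F.P K) S, cubeEnl (F.P K) S a 0 ⊆ s.Ω n →
            ∃ u : GaugeTransf (F.P K) 0 (SU N), ∃ A : PBond (F.P K) 0 → MatA N,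
              (∀ b ∈ (Sect2.regionOfSet (F.P K) (cubeEnl (F.P K) S a 0)).bonds,
                gaugeU (fun x => ιSU N (u x)) (fun b' => ιSU N (U b')) b = expI ((F.P K).eta n) (A b)) ∧
              (∀ b ∈ (Sect2.regionOfSet (F.P K) (cubeEnl (F.P K) S a 0)).bonds, ‖A b‖ < B₃' * δ n) ∧
              ∀ q ∈ (Sect2.regionOfSet (F.P K) (cubeEnl (F.P K) S a 0)).dpairs,
                ‖grad ((F.P K).eta n) q.2.1 (fun y => A ⟨y, q.2.2⟩) q.1‖ < B₃' * δ n

variable {F N}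

/-- OLD ⇒ NEW: the floor-free gauge-fixing fact implies its floor-carrying twin for every floor `c` (the floor only weakens). [cite: Balaban1985Variational, (152) p.301 (bookkeeping)] -/
theorem Gauge152OfClassTopStep.toR {Sup : (ν : Stage7Numerics) → (K : ℕ) → (ℕ → Set (Site (F.P K) 0)) → Set (Site (F.P K) 0)} {M : ℕ} {B₉ a₀ : ℝ}
    (h : Gauge152OfClassTopStep F N Sup M B₉ a₀) (c : ℕ) : Gauge152OfClassTopStepR F N Sup M c B₉ a₀ :=
  fun ν g K k s hsep hM₁ _ hk => h ν g K k s hsep hM₁ hk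

/-- OLD ⇒ NEW for the (9)-step fact. [cite: Balaban1985Variational, Thm 1 (9) p.279 (bookkeeping)] -/
theorem Gauge9RegSepTopStep.toR {Sup : (ν : Stage7Numerics) → (K : ℕ) → (ℕ → Set (Site (F.P K) 0)) → Set (Site (F.P K) 0)} {M : ℕ} {B₃ B₃' a₀ a₁ : ℝ}
    (h : Gauge9RegSepTopStep F N Sup M B₃ B₃' a₀ a₁) (c : ℕ) : Gauge9RegSepTopStepR F N Sup M c B₃ B₃' a₀ a₁ :=
  fun ν g K k s hsep hM₁ _ hk => h ν g K k s hsep hM₁ hk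

/-- The floor-carrying gauge-fixing fact is ANTITONE in the ceiling `a₀`. [cite: Balaban1985Variational, (152) p.301 («9dL²Mε₀ ≦ c₁»; bookkeeping)] -/
theorem Gauge152OfClassTopStepR.of_le {Sup : (ν : Stage7Numerics) → (K : ℕ) → (ℕ → Set (Site (F.P K) 0)) → Set (Site (F.P K) 0)} {M c : ℕ} {B₉ a₀ a₀' : ℝ}
    (h : Gauge152OfClassTopStepR F N Sup M c B₉ a₀) (ha₀ : a₀' ≤ a₀) : Gauge152OfClassTopStepR F N Sup M c B₉ a₀' :=
  fun ν g K k s hsep hM₁ hc hk ε hε hcomp hcomp' U h17 h19 =>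
    h ν g K k s hsep hM₁ hc hk ε (fun m hm => ⟨(hε m hm).1, (hε m hm).2.trans ha₀⟩) hcomp hcomp' U h17 h19

/-- The floor-carrying gauge-fixing fact is MONOTONE in the floor. [cite: Balaban1985RegularSpaces, (1.3)–(1.6) p.77 (bookkeeping)] -/
theorem Gauge152OfClassTopStepR.mono_floor {Sup : (ν : Stage7Numerics) → (K : ℕ) → (ℕ → Set (Site (F.P K) 0)) → Set (Site (F.P K) 0)} {M c c' : ℕ} {B₉ a₀ : ℝ}
    (h : Gauge152OfClassTopStepR F N Sup M c B₉ a₀) (hc : c ≤ c') : Gauge152OfClassTopStepR F N Sup M c' B₉ a₀ :=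
  fun ν g K k s hsep hM₁ hc' hk => h ν g K k s hsep hM₁ (hc.trans hc') hk

/-- The floor-carrying (9)-step fact is ANTITONE in the ceilings. [cite: Balaban1985Variational, Thm 1 p.279 (bookkeeping)] -/
theorem Gauge9RegSepTopStepR.of_le {Sup : (ν : Stage7Numerics) → (K : ℕ) → (ℕ → Set (Site (F.P K) 0)) → Set (Site (F.P K) 0)} {M c : ℕ}
    {B₃ B₃' a₀ a₁ a₀' a₁' : ℝ} (h : Gauge9RegSepTopStepR F N Sup M c B₃ B₃' a₀ a₁) (ha₀ : a₀' ≤ a₀) (ha₁ : a₁' ≤ a₁) :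
    Gauge9RegSepTopStepR F N Sup M c B₃ B₃' a₀' a₁' := by
  intro ν g K k s hsep hM₁ hc hk ε₀ δ hδ hcomp hcomp' hε₀
  exact h ν g K k s hsep hM₁ hc hk ε₀ δ (fun n hn => ⟨(hδ n hn).1, (hδ n hn).2.1.trans ha₁, (hδ n hn).2.2⟩) hcomp hcomp' (hε₀.trans ha₀)

/-- The floor-carrying (9)-step fact is MONOTONE in the floor. [cite: Balaban1985RegularSpaces, (1.3)–(1.6) p.77 (bookkeeping)] -/
theorem Gauge9RegSepTopStepR.mono_floor {Sup : (ν : Stage7Numerics) → (K : ℕ) → (ℕ → Set (Site (F.P K) 0)) → Set (Site (F.P K) 0)} {M c c' : ℕ}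
    {B₃ B₃' a₀ a₁ : ℝ} (h : Gauge9RegSepTopStepR F N Sup M c B₃ B₃' a₀ a₁) (hc : c ≤ c') : Gauge9RegSepTopStepR F N Sup M c' B₃ B₃' a₀ a₁ :=
  fun ν g K k s hsep hM₁ hc' hk => h ν g K k s hsep hM₁ (hc.trans hc') hk

/-- ★ **THE REDUCTION WITH THE FLOOR THREADED** (p532575's `gauge9RegSepTopStep_of_prop8TopStep_of_gauge152`, verbatim otherwise): (9) line 1 for critical points ⟸
[15] Prop. 8's top step ∧ the floor-carrying gauge-fixing half. [cite: Balaban1985Variational, Sect. F pp.300–305, Prop. 8 p.304, (152) p.301, Thm 1 (8)–(9) p.279] -/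
theorem gauge9R_of_prop8TopStep_of_gauge152R
    {Sup : (ν : Stage7Numerics) → (K : ℕ) → (ℕ → Set (Site (F.P K) 0)) → Set (Site (F.P K) 0)} {M c : ℕ} {B₃ B₉ a₀ a₀' a₁ : ℝ}
    (h8 : Prop8RegSepTopStep F N Sup B₃ a₀ a₁) (h152 : Gauge152OfClassTopStepR F N Sup M c B₉ a₀') (hB₃ : 0 < B₃) (ha : B₃ * a₁ ≤ a₀') :
    Gauge9RegSepTopStepR F N Sup M c B₃ (B₉ * B₃) a₀ a₁ := by
  intro ν g K k s hsep hM₁ hc hk ε₀ δ hδ hcomp hcomp' hε₀ W h7 U h17 h19 hfib hcrit n hn1 hnk S hS hSN a ha' hΩ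
  obtain ⟨h8p, h8c⟩ := h8 ν M g K k s hsep hM₁ hk ε₀ δ hδ hcomp hcomp' hε₀ W h7 U h17 h19 hfib hcrit
  have hε : ∀ m, m ≤ k → 0 < B₃ * δ m ∧ B₃ * δ m ≤ a₀' := fun m hm =>
    ⟨mul_pos hB₃ (hδ m hm).1, (mul_le_mul_of_nonneg_left (hδ m hm).2.1 hB₃.le).trans ha⟩
  have hc1 : ∀ m, m < k → B₃ * δ m ≤ 2 * (B₃ * δ (m + 1)) := fun m hm => by
    have := mul_le_mul_of_nonneg_left (hcomp m hm) hB₃.le; linarith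
  have hc2 : ∀ m, m < k → B₃ * δ (m + 1) ≤ 2 * (B₃ * δ m) := fun m hm => by
    have := mul_le_mul_of_nonneg_left (hcomp' m hm) hB₃.le; linarith
  obtain ⟨u, A, hexp, hA, hgrad⟩ := h152 ν g K k s hsep hM₁ hc hk (fun m => B₃ * δ m) hε hc1 hc2 U h8p h8c n hn1 hnk S hS hSN a ha' hΩ
  refine ⟨u, A, hexp, fun b hb => ?_, fun q hq => ?_⟩
  · calc ‖A b‖ < B₉ * (B₃ * δ n) := hA b hb
      _ = B₉ * B₃ * δ n := by ring
  · calc ‖grad ((F.P K).eta n) q.2.1 (fun y => A ⟨y, q.2.2⟩) q.1‖ < B₉ * (B₃ * δ n) := hgrad q hq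
      _ = B₉ * B₃ * δ n := by ring

end Tokens

/-! ## §2  The collar of a scale-1 cube projects into the support of record (`hullD M₁ 1 (Ω 1)`) -/

section Support

variable {P : Params}

/-- A cover point within sup-distance `s` (`s ≥ 1`) of a point projecting into `X` projects into `hullD P s 1 X` = «`X` + one layer of `s`-cubes» ([III] p. 255's
support: the cube of the point meets `X` within one layer). [cite: Balaban1988Convergent, p.255 («a small neighborhood of Ω₁ including a layer of M₁-cubes»), (2.13) p.256] -/
theorem cover_mem_hullD_one_of_within {s : ℕ} (hs : 0 < s) {X : Set (Site P 0)} {y z : Pt P.d} (hy : cover P y ∈ X) (hz : Within (s : ℤ) z y) :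
    cover P z ∈ hullD P s 1 X := by
  classical
  unfold hullD
  refine Set.mem_iUnion₂.2 ⟨cubeOfSite s (cover P z), Finset.mem_filter.2 ⟨cubeOfSite_mem_cubeIndices s hs _, ?_⟩,
    B15Claim189CubePin.mem_cubeEnl_cubeOfSite s hs _⟩
  -- the witness: `π y`, lifted next to `lift (π z)`
  obtain ⟨w, hw⟩ := (cover_eq_cover_iff z (lift P (cover P z))).1 (by rw [cover_lift])
  refine ⟨cover P y, ⟨y + pmul (per P) w, ?_, cover_add_pmul y w⟩, hy⟩
  refine mem_cubeExt_cubeIdx_of_near s hs (lift P (cover P z)) (y + pmul (per P) w) fun i => ?_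
  have h1 := abs_le.1 (hz i)
  have h2 := congrFun hw i
  simp only [Pi.add_apply] at h2 ⊢
  push_cast
  constructor <;> linarith

end Support

/-! ## §3  [6] Proposition 6 at NODE 00's `ℤᵈ` member ⇒ the floor-carrying gauge-fixing token (d = 4) -/

section Wrapper

variable (F : T4Family) (N : ℕ) [NeZero N]

/-- The constant `B₉(L, M, B₁) = 112·L⁵·B₁·(LM + 44 + L) + 1` of `gauge152R_of_prop6` (twice print's `7dL²B₁M′` at `α₀ = L³ε_{n−1} ≤ 2L³ε_n`, the larger cube family,
`+1` for the strict inequality). [cite: Balaban1985Variational, (152) p.301 («9dL²B₁Mε₀»; bookkeeping)] -/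
def b9Of (M : ℕ) (B₁ : ℝ) : ℝ := 112 * (F.L : ℝ) ^ 5 * B₁ * ((F.L * M + 44 + F.L : ℕ) : ℝ) + 1

/-- The ceiling `a₀(L, N, M, B₁, c₁)` of `gauge152R_of_prop6` (print's «9dL²Mε₀ ≦ c₁» and the `2π`-window of the determinant normalisation, both at the larger family).
[cite: Balaban1985Variational, (152) p.301 («We assume that 9dL²Mε₀ ≦ c₁»; bookkeeping)] -/
def a0Of (M : ℕ) (B₁ c₁ : ℝ) : ℝ :=
  min (c₁ / (56 * (F.L : ℝ) ^ 5 * ((F.L * M + 44 + F.L : ℕ) : ℝ)))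
    (1 / (8 * ((F.L * M + 44 + F.L : ℕ) : ℝ) * N * (28 * (F.L : ℝ) ^ 5 * B₁ * ((F.L * M + 44 + F.L : ℕ) : ℝ)) + 1))

variable {F N}

omit [NeZero N] in
/-- `0 < a₀` when `0 < c₁` and `0 ≤ B₁` (the token at this ceiling is not vacuous). [cite: Balaban1985Variational, (152) p.301 (bookkeeping)] -/
theorem a0Of_pos (M : ℕ) {B₁ c₁ : ℝ} (hB₁ : 0 ≤ B₁) (hc₁ : 0 < c₁) : 0 < a0Of F N M B₁ c₁ := by
  have hL : (0 : ℝ) < F.L := by exact_mod_cast (F.P 0).L_pos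
  have hM' : (0 : ℝ) < ((F.L * M + 44 + F.L : ℕ) : ℝ) := by positivity
  unfold a0Of
  exact lt_min (by positivity) (by positivity)

/-- `0 < B₉`. [cite: Balaban1985Variational, (152) p.301 (bookkeeping)] -/
theorem b9Of_pos (M : ℕ) {B₁ : ℝ} (hB₁ : 0 ≤ B₁) : 0 < b9Of F M B₁ := by
  unfold b9Of; positivity

/-- At scale `n = 1` the collar of the Proposition-6 cube projects into the SUPPORT of record `hullD M₁ 1 (Ω 1)` ([III] p. 255), under the floor `(11d + 3L)·L ≤ M₁`
(`□ = cubeEnl P (L·M) a 0 ⊆ Ω 1`, `M ≥ 1`). [cite: Balaban1988Convergent, p.255; Balaban1985Variational, (144) p.300] -/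
theorem cover_image_Ω_cubeIdx'_one_subset_hullD {P : Params} {M₁ : ℕ} (hfloor : (11 * P.d + 3 * P.L) * P.L ≤ M₁) {Ω : ℕ → Set (Site P 0)} {M : ℕ} (hM : 1 ≤ M)
    (a : Pt P.d) (hΩ : cubeEnl P (side P.L M 1) a 0 ⊆ Ω 1) (j : ℕ) :
    cover P '' (cubeIdx' P 1 le_rfl M a).Ω j ⊆ hullD P M₁ 1 (Ω 1) := by
  rintro _ ⟨z, hz, rfl⟩
  rw [cubeIdx'_Ω] at hz
  have hL := P.hL.2
  have hM₁ : 0 < M₁ := lt_of_lt_of_le (by nlinarith) hfloor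
  obtain ⟨y, hy, hzy⟩ := exists_mem_box_within_of_mem_tcube (L := P.L) P.L_pos _ hM (Nat.le_add_right M (11 * P.d + P.L))
    P.L 1 (z := z) (by rwa [show M + 11 * P.d + P.L = M + (11 * P.d + P.L) by ring] at hz)
  have hy' : cover P y ∈ Ω 1 := by
    refine hΩ ⟨y, ?_, rfl⟩
    simp only [Nat.zero_mul, Nat.cast_zero]
    rw [cubeExt_side_eq_box]; exact hy
  refine cover_mem_hullD_one_of_within hM₁ hy' fun i => (hzy i).trans ?_
  have h1 : ((M + (11 * P.d + P.L) - M + 2 * P.L) * P.L ^ 1 : ℕ) = (11 * P.d + 3 * P.L) * P.L := by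
    rw [Nat.add_sub_cancel_left, pow_one]; ring
  rw [h1]; exact_mod_cast hfloor

/-- The total width of the Proposition-6 cube `𝔔` of a grid cube: `W = d·(LⁿM′ − 1)`. [cite: Balaban1985RegularSpaces, p.98 (bookkeeping)] -/
theorem boxWidth_propCube (P : Params) (n : ℕ) (hn : 1 ≤ n) (M : ℕ) (a : Pt P.d) :
    boxWidth (bLo P.L (propCube P n hn M a).a (propCube P n hn M a).k 0) (bHi P.L (propCube P n hn M a).a (propCube P n hn M a).M (propCube P n hn M a).k 0) =
      P.d * ((P.L : ℝ) ^ n * ((M + 11 * P.d + P.L : ℕ) : ℝ) - 1) := by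
  simp only [boxWidth, propCube_a, propCube_M, propCube_k, bLo, bHi, Nat.cast_zero, sub_zero, add_zero]
  have : ∀ μ : Fin P.d, (((P.L : ℤ) ^ n * ((M : ℤ) * a μ + ((M + 11 * P.d + P.L : ℕ) : ℤ)) - 1 - (P.L : ℤ) ^ n * ((M : ℤ) * a μ) : ℤ) : ℝ) =
      (P.L : ℝ) ^ n * ((M + 11 * P.d + P.L : ℕ) : ℝ) - 1 := fun μ => by push_cast; ring
  rw [Finset.sum_congr rfl fun μ _ => this μ, Finset.sum_const, Finset.card_univ, Fintype.card_fin, nsmul_eq_mul]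

/-- ★★★ **[6] PROPOSITION 6 AT NODE 00's `ℤᵈ × M_N(ℂ)` MEMBER ⇒ THE FLOOR-CARRYING GAUGE-FIXING TOKEN OF THE K0 ROAD, FOR EVERY CUBE LETTER `M`** (`d = 4`,
`Sup = suppDomOfRecord`, floor `c = (44 + 3L)·L`, `B₉ = b9Of F M B₁`, `a₀ = a0Of F N M B₁ c₁`): the (9)-half of [15] Thm 1 on the K0 road is N05's node BY NAME
(`hP6` = node00-def-cube's Proposition-6 slot over n05-a's whole index).  Proof = FILE 4b at each cube of the two families (`LⁿM`: cube letter `M`; `L^{n+1}M` =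
`Lⁿ·(LM)`: cube letter `LM`), the collar clause from FILE 2 (`n ≥ 2`, print's separation) or §2 (`n = 1`, the support), the smallnesses from `ε ≤ a₀`, and
`ε_{n−1} ≤ 2ε_n`. [cite: Balaban1985Variational, (144)–(152) pp.300–301, Thm 1 (9) p.279; Balaban1985RegularSpaces, Prop. 6 p.99; Balaban1988Convergent, p.255–256] -/
theorem gauge152R_of_prop6 {B₁ c₁ : ℝ} (hB₁ : 0 ≤ B₁) (hc₁ : 0 < c₁)
    (hP6 : letI : CStarAlgebra (MatA N) := {}; B8.Prop6Printed 4 (F.L : ℝ) B₁ c₁ (fun i : ZdIdx 4 F.L => zdCub (MatA N) F.L i)) (M : ℕ) :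
    Gauge152OfClassTopStepR F N (fun ν K Ω => suppDomOfRecord F ν K Ω) M ((11 * 4 + 3 * F.L) * F.L) (b9Of F M B₁) (a0Of F N M B₁ c₁) := by
  intro ν g K k s hsep hM₁ hfloor hk ε hε hcomp hcomp' U h17 h19 n hn1 hnk S hS hSN a _ hΩ
  have hL2 : 2 ≤ F.L := (F.P 0).hL.2
  have hL : (1 : ℝ) ≤ F.L := by exact_mod_cast (F.P 0).L_pos
  have hd : 2 ≤ (F.P K).d := by rw [T4Family.P_d]; norm_num
  have hNr : (1 : ℝ) ≤ N := by exact_mod_cast NeZero.pos N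
  set M₂ : ℕ := F.L * M + 44 + F.L with hM₂
  have ha₀ := a0Of_pos (F := F) (N := N) M hB₁ hc₁
  -- the case `M = 0`: the cube is empty
  rcases Nat.eq_zero_or_pos M with hM0 | hMpos
  · subst hM0
    have hS0 : S = 0 := by rcases hS with h | h <;> simp [h, side]
    subst hS0
    have hempty : ∀ y, y ∉ cubeEnl (F.P K) 0 a 0 := by
      rintro y ⟨z, hz, -⟩
      have h0 := hz ⟨0, by rw [T4Family.P_d]; norm_num⟩
      simp only [Nat.cast_zero, zero_mul, sub_zero, add_zero] at h0
      omega
    exact ⟨fun _ => 1, fun _ => 0, fun b hb => (hempty _ hb.1).elim, fun b hb => (hempty _ hb.1).elim, fun q hq => (hempty _ hq.1).elim⟩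
  -- the generic cube letter `M₀ ∈ {M, LM}` at scale `n`
  have key : ∀ M₀ : ℕ, 1 ≤ M₀ → M₀ + 44 + F.L ≤ M₂ → ((side (F.P K).L M₀ n : ℕ) : ℤ) < (F.P K).sitesPerDir 0 →
      cubeEnl (F.P K) (side (F.P K).L M₀ n) a 0 ⊆ s.Ω n →
      ∃ u : GaugeTransf (F.P K) 0 (SU N), ∃ A : PBond (F.P K) 0 → MatA N,
        (∀ b ∈ (Sect2.regionOfSet (F.P K) (cubeEnl (F.P K) (side (F.P K).L M₀ n) a 0)).bonds,
          gaugeU (fun x => ιSU N (u x)) (fun b' => ιSU N (U b')) b = expI ((F.P K).eta n) (A b)) ∧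
        (∀ b ∈ (Sect2.regionOfSet (F.P K) (cubeEnl (F.P K) (side (F.P K).L M₀ n) a 0)).bonds, ‖A b‖ < b9Of F M B₁ * ε n) ∧
        ∀ q ∈ (Sect2.regionOfSet (F.P K) (cubeEnl (F.P K) (side (F.P K).L M₀ n) a 0)).dpairs,
          ‖grad ((F.P K).eta n) q.2.1 (fun y => A ⟨y, q.2.2⟩) q.1‖ < b9Of F M B₁ * ε n := by
    intro M₀ hM₀ hM₀' hSN₀ hΩ₀
    have hεn1 : 0 < ε (n - 1) := (hε (n - 1) (by omega)).1
    have hεn1a : ε (n - 1) ≤ a0Of F N M B₁ c₁ := (hε (n - 1) (by omega)).2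
    have hεn : 0 < ε n := (hε n hnk).1
    have hε2 : ε (n - 1) ≤ 2 * ε n := by
      have := hcomp (n - 1) (by omega)
      rwa [show n - 1 + 1 = n by omega] at this
    have hM₀r : ((M₀ + 11 * 4 + F.L : ℕ) : ℝ) ≤ (M₂ : ℝ) := by exact_mod_cast (by omega : M₀ + 11 * 4 + F.L ≤ M₂)
    have hM₂pos : (0 : ℝ) < M₂ := by positivity
    have hM₀pos : (0 : ℝ) < ((M₀ + 11 * 4 + F.L : ℕ) : ℝ) := by positivity
    -- the collar clause
    have hcollar : cover (F.P K) '' (cubeIdx' (F.P K) n hn1 M₀ a).Ω 0 ⊆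
        (if n - 1 = 0 then suppDomOfRecord F ν K s.Ω else s.Ω (n - 1)) := by
      rcases Nat.eq_or_lt_of_le hn1 with h1 | h1
      · subst h1
        rw [if_pos rfl, suppDomOfRecord_eq]
        exact cover_image_Ω_cubeIdx'_one_subset_hullD (by rw [T4Family.P_d, T4Family.P_L]; exact hfloor) hM₀ a hΩ₀ 0
      · rw [if_neg (by omega)]
        refine cover_image_Ω_cubeIdx'_subset (F.P K) s hsep ?_ h1 hnk hM₀ a hΩ₀ 0
        rw [T4Family.P_d, T4Family.P_L]
        exact le_trans (Nat.le_mul_of_pos_right _ (F.P 0).L_pos) hfloor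
    -- the smallness «7dL²M′α₀ ≤ c₁»
    have ha₀c : a0Of F N M B₁ c₁ ≤ c₁ / (56 * (F.L : ℝ) ^ 5 * M₂) := by rw [hM₂]; exact min_le_left _ _
    have ha₀w : a0Of F N M B₁ c₁ ≤ 1 / (8 * (M₂ : ℝ) * N * (28 * (F.L : ℝ) ^ 5 * B₁ * M₂) + 1) := by rw [hM₂]; exact min_le_right _ _
    have hc₁' : 7 * (F.P K).d * ((F.P K).L : ℝ) ^ 2 * (propCube (F.P K) n hn1 M₀ a).M * (((F.P K).L : ℝ) ^ 3 * ε (n - 1)) ≤ c₁ := by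
      rw [propCube_M, T4Family.P_d, T4Family.P_L]
      have h1 : 7 * (4 : ℕ) * (F.L : ℝ) ^ 2 * ((M₀ + 11 * 4 + F.L : ℕ) : ℝ) * ((F.L : ℝ) ^ 3 * ε (n - 1)) ≤ 28 * (F.L : ℝ) ^ 5 * M₂ * a0Of F N M B₁ c₁ := by
        have : 7 * (4 : ℕ) * (F.L : ℝ) ^ 2 * ((M₀ + 11 * 4 + F.L : ℕ) : ℝ) * ((F.L : ℝ) ^ 3 * ε (n - 1)) =
            28 * (F.L : ℝ) ^ 5 * ((M₀ + 11 * 4 + F.L : ℕ) : ℝ) * ε (n - 1) := by push_cast; ring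
        rw [this]; gcongr
      have h2 : 28 * (F.L : ℝ) ^ 5 * M₂ * a0Of F N M B₁ c₁ ≤ 28 * (F.L : ℝ) ^ 5 * M₂ * (c₁ / (56 * (F.L : ℝ) ^ 5 * M₂)) :=
        mul_le_mul_of_nonneg_left ha₀c (by positivity)
      have h3 : 28 * (F.L : ℝ) ^ 5 * M₂ * (c₁ / (56 * (F.L : ℝ) ^ 5 * M₂)) = c₁ / 2 := by field_simp; ring
      linarith
    -- the `2π`-window of the normalisation
    have h2π : (2 * boxWidth (bLo (F.P K).L (propCube (F.P K) n hn1 M₀ a).a (propCube (F.P K) n hn1 M₀ a).k 0)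
        (bHi (F.P K).L (propCube (F.P K) n hn1 M₀ a).a (propCube (F.P K) n hn1 M₀ a).M (propCube (F.P K) n hn1 M₀ a).k 0) + 1) *
        ((F.P K).eta n * N * (7 * (F.P K).d * ((F.P K).L : ℝ) ^ 2 * B₁ * (propCube (F.P K) n hn1 M₀ a).M * (((F.P K).L : ℝ) ^ 3 * ε (n - 1)) *
          (((F.P K).L : ℝ) ^ (propCube (F.P K) n hn1 M₀ a).k * (F.P K).eta n)⁻¹)) < 2 * Real.pi := by
      rw [boxWidth_propCube, propCube_M, propCube_k, B12Eq115BackgroundPair.pow_mul_eta, inv_one, mul_one, T4Family.P_d, T4Family.P_L]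
      have hη : (F.L : ℝ) ^ n * (F.P K).eta n = 1 := by have := B12Eq115BackgroundPair.pow_mul_eta (F.P K) n; rwa [T4Family.P_L] at this
      have hηpos : 0 < (F.P K).eta n := B3GkZeroTorusRescaled.eta_pos (F.P K) n
      -- `(2W + 1)·η_n ≤ 8M′`
      have hW : (2 * ((4 : ℕ) * ((F.L : ℝ) ^ n * ((M₀ + 11 * 4 + F.L : ℕ) : ℝ) - 1)) + 1) * (F.P K).eta n ≤ 8 * ((M₀ + 11 * 4 + F.L : ℕ) : ℝ) := by
        have : (2 * ((4 : ℕ) * ((F.L : ℝ) ^ n * ((M₀ + 11 * 4 + F.L : ℕ) : ℝ) - 1)) + 1) * (F.P K).eta n =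
            8 * ((M₀ + 11 * 4 + F.L : ℕ) : ℝ) * ((F.L : ℝ) ^ n * (F.P K).eta n) - 7 * (F.P K).eta n := by push_cast; ring
        rw [this, hη, mul_one]; linarith
      have hr : 7 * (4 : ℕ) * (F.L : ℝ) ^ 2 * B₁ * ((M₀ + 11 * 4 + F.L : ℕ) : ℝ) * ((F.L : ℝ) ^ 3 * ε (n - 1)) ≤ 28 * (F.L : ℝ) ^ 5 * B₁ * M₂ * a0Of F N M B₁ c₁ := by
        have : 7 * (4 : ℕ) * (F.L : ℝ) ^ 2 * B₁ * ((M₀ + 11 * 4 + F.L : ℕ) : ℝ) * ((F.L : ℝ) ^ 3 * ε (n - 1)) =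
            28 * (F.L : ℝ) ^ 5 * B₁ * ((M₀ + 11 * 4 + F.L : ℕ) : ℝ) * ε (n - 1) := by push_cast; ring
        rw [this]; gcongr
      set X : ℝ := 8 * (M₂ : ℝ) * N * (28 * (F.L : ℝ) ^ 5 * B₁ * M₂) with hX
      have hX0 : 0 ≤ X := by positivity
      have hXa : X * a0Of F N M B₁ c₁ < 1 := by
        calc X * a0Of F N M B₁ c₁ ≤ X * (1 / (X + 1)) := mul_le_mul_of_nonneg_left ha₀w hX0
          _ < 1 := by rw [mul_one_div, div_lt_one (by positivity)]; linarith
      calc (2 * ((4 : ℕ) * ((F.L : ℝ) ^ n * ((M₀ + 11 * 4 + F.L : ℕ) : ℝ) - 1)) + 1) *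
            ((F.P K).eta n * N * (7 * (4 : ℕ) * (F.L : ℝ) ^ 2 * B₁ * ((M₀ + 11 * 4 + F.L : ℕ) : ℝ) * ((F.L : ℝ) ^ 3 * ε (n - 1))))
          = ((2 * ((4 : ℕ) * ((F.L : ℝ) ^ n * ((M₀ + 11 * 4 + F.L : ℕ) : ℝ) - 1)) + 1) * (F.P K).eta n) *
            (N * (7 * (4 : ℕ) * (F.L : ℝ) ^ 2 * B₁ * ((M₀ + 11 * 4 + F.L : ℕ) : ℝ) * ((F.L : ℝ) ^ 3 * ε (n - 1)))) := by ring
        _ ≤ (8 * ((M₀ + 11 * 4 + F.L : ℕ) : ℝ)) * (N * (28 * (F.L : ℝ) ^ 5 * B₁ * M₂ * a0Of F N M B₁ c₁)) := by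
            gcongr
        _ ≤ (8 * (M₂ : ℝ)) * (N * (28 * (F.L : ℝ) ^ 5 * B₁ * M₂ * a0Of F N M B₁ c₁)) := by gcongr
        _ = X * a0Of F N M B₁ c₁ := by rw [hX]; ring
        _ < 1 := hXa
        _ < 2 * Real.pi := by linarith [Real.pi_gt_three]
    obtain ⟨u, A, h1, h2, h3⟩ := exists_localGauge_cube_of_prop6 (P := F.P K) hd hB₁ hP6 U h17 h19 hn1 (by omega) hεn1 a hSN₀ hcollar hc₁' h2π
    -- the letters at `B₉·ε_n`
    have hbound : 2 * (7 * (F.P K).d * ((F.P K).L : ℝ) ^ 2 * B₁ * (propCube (F.P K) n hn1 M₀ a).M * (((F.P K).L : ℝ) ^ 3 * ε (n - 1))) <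
        b9Of F M B₁ * ε n := by
      rw [propCube_M, T4Family.P_d, T4Family.P_L, b9Of]
      have : 2 * (7 * (4 : ℕ) * (F.L : ℝ) ^ 2 * B₁ * ((M₀ + 11 * 4 + F.L : ℕ) : ℝ) * ((F.L : ℝ) ^ 3 * ε (n - 1))) =
          56 * (F.L : ℝ) ^ 5 * B₁ * ((M₀ + 11 * 4 + F.L : ℕ) : ℝ) * ε (n - 1) := by push_cast; ring
      rw [this]
      calc 56 * (F.L : ℝ) ^ 5 * B₁ * ((M₀ + 11 * 4 + F.L : ℕ) : ℝ) * ε (n - 1) ≤ 56 * (F.L : ℝ) ^ 5 * B₁ * M₂ * (2 * ε n) := by gcongr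
        _ = (112 * (F.L : ℝ) ^ 5 * B₁ * M₂) * ε n := by ring
        _ < (112 * (F.L : ℝ) ^ 5 * B₁ * ((F.L * M + 44 + F.L : ℕ) : ℝ) + 1) * ε n := by
            rw [hM₂]; exact mul_lt_mul_of_pos_right (lt_add_one _) hεn
    exact ⟨u, A, h1, fun b hb => (h2 b hb).trans_lt hbound, fun q hq => (h3 q hq).trans_lt hbound⟩
  -- the two families
  rcases hS with rfl | rfl
  · exact key M hMpos (by rw [hM₂]; nlinarith [(F.P 0).L_pos]) hSN hΩ
  · have hside : side (F.P K).L M (n + 1) = side (F.P K).L ((F.P K).L * M) n := by simp only [side, pow_succ]; ring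
    rw [hside] at hSN hΩ ⊢
    exact key ((F.P K).L * M) (Nat.one_le_iff_ne_zero.2 (Nat.mul_ne_zero (F.P K).L_pos.ne' hMpos.ne')) (by rw [hM₂, T4Family.P_L]) hSN hΩ

end Wrapper

end Literature.MathematicalPhysics.QuantumFieldTheory.Balaban1983to89.Node00

end
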